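import Literature.Geometry.Riemannian.CutLocusConjugate
import Literature.Geometry.Riemannian.CutLocusMinimizers
import Literature.Geometry.Riemannian.ExpMapIndexForm
import HarnessLib

/-!
# Buchner's characterisation of the cut locus: first conjugate point on a minimizer, or two minimizers

Topic `Geometry/Riemannian`; eighth support file of the programme towards the named fact
`Literature.Geometry.Riemannian.buchner1977_cutLocus_triangulable` of `CutLocus.lean`
(M. A. Buchner, *Simplicial structure of the real analytic cut locus*, Proc. AMS 64 (1977)
118–121). Buchner, p. 118 (citing [6]): "Recall that `x ∈ C(p)` if and only if `x` is the first
conjugate point on a length minimizing geodesic starting at `p` and going through `x`, or there are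
at least two length minimizing geodesics from `p` to `x`." This is the set-theoretic input of his
description `C(p) = {x | E|π⁻¹(x) has a degenerate minimum or at least two minima}` (p. 119). This
file PROVES the characterisation for the metric cut locus `cutLocus g hg p` of `CutLocus.lean`, for
a smooth Riemannian metric with geodesically complete Levi-Civita connection on a connected
Hausdorff manifold without boundary (in particular on compact ones):

* `mem_tangentCutLocus_of_isConjugateVector`, `expMap_mem_cutLocus_of_isConjugateVector` — **a
  minimizing segment `γ_v|[0,1]` whose endpoint is conjugate (i.e. `v` is a critical vector of
  `exp_p`) cannot be prolonged minimally**: `v ∈ TCL(p)` and `exp_p v ∈ cutLocus p`. This is the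
  remaining "if" of the characterisation, from the other seats' Thm. 10.26/10.34 result
  `mfderiv_riemannianExpMap_injective_of_mem_injectivityDomain` (`ExpMapIndexForm.lean`: on the
  injectivity domain the differential of `exp_p` is injective) read contrapositively;
* `not_isConjugateVector_smul_of_isMinimizingUpTo` — before the endpoint of a minimizing segment
  there are no conjugate vectors (`t v ∈ ID(p)` for `0 < t < 1`), so a conjugate endpoint is the
  FIRST conjugate point, `expMap_mem_firstConjugateLocus`;
* `mem_cutLocus_iff_exists_minimizer` — **`q ∈ cutLocus p` iff `q = exp_p v` for a minimizing
  `γ_v|[0,1]`, `v ≠ 0`, with `v` conjugate or a second minimizing `γ_w|[0,1]`, `w ≠ v`, to `q`**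
  (`⇒`: `exists_minimizer_of_mem_cutLocus`, `CutLocusConjugate.lean`; `⇐`: the above and
  `expMap_mem_cutLocus_of_ne`, `CutLocusMinimizers.lean`); `mem_tangentCutLocus_iff` likewise;
* `cutLocus_subset_firstConjugateLocus_union`, `cutLocus_eq_firstConjugateLocus_inter_union` —
  Buchner's sentence verbatim: `cutLocus p = (first conjugate points along minimizers) ∪ (points with
  two minimizers)`, and the compact-manifold corollaries.

No definitions, no named facts (D-0026); theorem-only file.

## References

* [Buchner1977Simplicial] M. A. Buchner, Proc. AMS 64 (1977), p. 118.
* [LeeRiemannianManifolds2018] J. M. Lee, Introduction to Riemannian Manifolds, 2nd ed. (2018),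
  Thm. 10.26, Prop. 10.32, Thm. 10.33, Thm. 10.34.
-/

noncomputable section

open Bundle Set Filter Manifold Function
open scoped Manifold ContDiff Topology ENNReal NNReal

namespace Literature.Geometry.Riemannian

open Literature.Geometry.Lorentzian
open Literature.Geometry.Lorentzian.PseudoRiemannianMetric

variable {E : Type*} [NormedAddCommGroup E] [NormedSpace ℝ E] {H : Type*} [TopologicalSpace H]
  {I : ModelWithCorners ℝ E H} {M : Type*} [TopologicalSpace M] [ChartedSpace H M]
  [IsManifold I ∞ M] {n : ℕ∞ω} [FiniteDimensional ℝ E] [CompleteSpace E] [T2Space M]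
  [BoundarylessManifold I M]
  {g : PseudoRiemannianMetric I n E (TangentSpace I : M → Type _)} [g.HasLeviCivita]
  [CovariantDerivative.ContMDiffCovariantDerivative g.leviCivita 1]

/-! ### Conjugate endpoints of minimizing segments are cut points -/

/-- **A minimizing segment with conjugate endpoint cannot be prolonged minimally**: if `v ≠ 0`,
`γ_v|[0,1]` is minimizing and `v` is a conjugate (critical) vector of `exp_p`, then `v ∈ TCL(p)` —
for if `γ_v|[0,s]` minimized for some `s > 1` then `v ∈ ID(p)` and `d(exp_p)_v` would be injective
(`mfderiv_riemannianExpMap_injective_of_mem_injectivityDomain`, Lee 2018, Thm. 10.26 with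
Prop. 10.20). [cite: LeeRiemannianManifolds2018, Thm. 10.26 and Prop. 10.20] -/
theorem mem_tangentCutLocus_of_isConjugateVector (hn : (∞ : ℕ∞ω) ≤ n) (hg : g.IsRiemannian)
    (hc : IsGeodesicallyComplete g.leviCivita) {p : M} {v : TangentSpace I p} (hv0 : v ≠ 0)
    (hmin : IsMinimizingUpTo g hg p v 1) (hconj : IsConjugateVector g p v) :
    v ∈ tangentCutLocus g hg p := by
  refine ⟨hv0, hmin, fun s hs hmins => ?_⟩
  have hvID : v ∈ injectivityDomain g hg p := ⟨s, hs, hmins⟩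
  exact hconj.2 (mfderiv_riemannianExpMap_injective_of_mem_injectivityDomain g hn hg hc p hvID)

/-- **The endpoint of a minimizing segment which is conjugate to `p` along it is a cut point of
`p`** (Buchner 1977, p. 118, "if", first alternative; Lee 2018, Thm. 10.26): on a connected
manifold, `exp_p v ∈ cutLocus p`. [cite: Buchner1977Simplicial, p. 118] -/
theorem expMap_mem_cutLocus_of_isConjugateVector [ConnectedSpace M] (hn : (∞ : ℕ∞ω) ≤ n)
    (hg : g.IsRiemannian) (hc : IsGeodesicallyComplete g.leviCivita) {p : M} {v : TangentSpace I p}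
    (hv0 : v ≠ 0) (hmin : IsMinimizingUpTo g hg p v 1) (hconj : IsConjugateVector g p v) :
    riemannianExpMap g p v ∈ cutLocus g hg p :=
  expMap_mem_cutLocus_of_mem_tangentCutLocus hn hg hc
    (mem_tangentCutLocus_of_isConjugateVector hn hg hc hv0 hmin hconj)

/-- **No conjugate vectors before the endpoint of a minimizing segment**: if `γ_v|[0,1]` is
minimizing and `0 < t < 1` then `t v` is not a conjugate vector (`t v ∈ ID(p)`, as `γ_{tv}`
minimises on `[0, 1/t]`, `1/t > 1`; Lee 2018, Thm. 10.26 (a minimizing segment has no interior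
conjugate points)). [cite: LeeRiemannianManifolds2018, Thm. 10.26] -/
theorem not_isConjugateVector_smul_of_isMinimizingUpTo (hn : (∞ : ℕ∞ω) ≤ n) (hg : g.IsRiemannian)
    (hc : IsGeodesicallyComplete g.leviCivita) {p : M} {v : TangentSpace I p}
    (hmin : IsMinimizingUpTo g hg p v 1) {t : ℝ} (ht : t ∈ Ioo (0 : ℝ) 1) :
    ¬ IsConjugateVector g p (t • v) := by
  haveI := fact_one_le_of_infty_le hn
  intro hconj
  have hID : t • v ∈ injectivityDomain g hg p := by
    refine ⟨t⁻¹, one_lt_inv₀ ht.1 |>.2 ht.2, ?_⟩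
    rw [isMinimizingUpTo_smul_iff hg hc p v ht.1 t⁻¹, mul_inv_cancel₀ ht.1.ne']
    exact hmin
  exact hconj.2 (mfderiv_riemannianExpMap_injective_of_mem_injectivityDomain g hn hg hc p hID)

/-- **A conjugate endpoint of a minimizing segment is the FIRST conjugate point along it**: if
`γ_v|[0,1]` is minimizing and `v` is a conjugate vector then `exp_p v` lies in the first conjugate
locus of `p` (`firstConjugateLocus`, `ExponentialMap.lean`), with parameter `t = 1`.
[cite: LeeRiemannianManifolds2018, Thm. 10.26] -/
theorem expMap_mem_firstConjugateLocus (hn : (∞ : ℕ∞ω) ≤ n) (hg : g.IsRiemannian)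
    (hc : IsGeodesicallyComplete g.leviCivita) {p : M} {v : TangentSpace I p}
    (hmin : IsMinimizingUpTo g hg p v 1) (hconj : IsConjugateVector g p v) :
    riemannianExpMap g p v ∈ firstConjugateLocus g p := by
  refine ⟨v, 1, one_pos, by rwa [one_smul], fun t' ht'0 ht'1 => ?_, by rw [one_smul]⟩
  exact not_isConjugateVector_smul_of_isMinimizingUpTo hn hg hc hmin ⟨ht'0, ht'1⟩

/-! ### The characterisation -/

/-- **The tangent cut locus through conjugate vectors and second minimizers**: on a connected
manifold, `v ∈ TCL(p)` iff `v ≠ 0`, `γ_v|[0,1]` is minimizing, and `v` is conjugate or there is a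
second minimizing `γ_w|[0,1]`, `w ≠ v`, with `exp_p w = exp_p v` (Lee 2018, Thm. 10.33 / proof of
Thm. 10.34; `isConjugateVector_or_exists_ne_of_mem_tangentCutLocus`,
`mem_tangentCutLocus_of_isConjugateVector`, `mem_tangentCutLocus_of_ne`).
[cite: LeeRiemannianManifolds2018, Prop. 10.32 and Thm. 10.33] -/
theorem mem_tangentCutLocus_iff [ConnectedSpace M] (hn : (∞ : ℕ∞ω) ≤ n) (hg : g.IsRiemannian)
    (hc : IsGeodesicallyComplete g.leviCivita) {p : M} {v : TangentSpace I p} :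
    v ∈ tangentCutLocus g hg p ↔ v ≠ 0 ∧ IsMinimizingUpTo g hg p v 1 ∧
      (IsConjugateVector g p v ∨ ∃ w : TangentSpace I p, w ≠ v ∧ IsMinimizingUpTo g hg p w 1 ∧
        riemannianExpMap g p w = riemannianExpMap g p v) := by
  constructor
  · intro hv
    exact ⟨hv.1, hv.2.1, isConjugateVector_or_exists_ne_of_mem_tangentCutLocus hn hg hc hv⟩
  · rintro ⟨hv0, hmin, hconj | ⟨w, hwv, hw, he⟩⟩
    · exact mem_tangentCutLocus_of_isConjugateVector hn hg hc hv0 hmin hconj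
    · exact mem_tangentCutLocus_of_ne hn hg hc hwv.symm hmin hw he

/-- **Buchner's characterisation of the cut locus** (Buchner 1977, p. 118: "`x ∈ C(p)` if and only
if `x` is the first conjugate point on a length minimizing geodesic starting at `p` and going
through `x`, or there are at least two length minimizing geodesics from `p` to `x`"), for the
metric cut locus of a smooth Riemannian metric with geodesically complete Levi-Civita connection on
a connected Hausdorff manifold without boundary: `q ∈ cutLocus p` iff `q = exp_p v` for some
minimizing `γ_v|[0,1]`, `v ≠ 0`, such that `v` is a conjugate vector of `exp_p` (then `q` is the
first conjugate point along `γ_v`, `expMap_mem_firstConjugateLocus`) or there is a second minimizing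
`γ_w|[0,1]`, `w ≠ v`, ending at `q`. [cite: Buchner1977Simplicial, p. 118] -/
theorem mem_cutLocus_iff_exists_minimizer [ConnectedSpace M] (hn : (∞ : ℕ∞ω) ≤ n)
    (hg : g.IsRiemannian) (hc : IsGeodesicallyComplete g.leviCivita) {p q : M} :
    q ∈ cutLocus g hg p ↔ ∃ v : TangentSpace I p, v ≠ 0 ∧ IsMinimizingUpTo g hg p v 1 ∧
      riemannianExpMap g p v = q ∧
      (IsConjugateVector g p v ∨ ∃ w : TangentSpace I p, w ≠ v ∧ IsMinimizingUpTo g hg p w 1 ∧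
        riemannianExpMap g p w = q) := by
  constructor
  · intro hq
    obtain ⟨v, hmin, hvq, halt⟩ := exists_minimizer_of_mem_cutLocus hn hg hc hq
    exact ⟨v, (mem_tangentCutLocus_of_mem_cutLocus hn hg hc hq hmin hvq).1, hmin, hvq, halt⟩
  · rintro ⟨v, hv0, hmin, hvq, hconj | ⟨w, hwv, hw, hwq⟩⟩
    · rw [← hvq]
      exact expMap_mem_cutLocus_of_isConjugateVector hn hg hc hv0 hmin hconj
    · rw [← hvq]
      exact expMap_mem_cutLocus_of_ne hn hg hc hwv.symm hmin hw (hwq.trans hvq.symm)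

/-- **`cutLocus p ⊆ (first conjugate locus of p) ∪ {points reached by two distinct minimizing
segments}`** — Buchner's sentence read as an inclusion of sets (p. 118).
[cite: Buchner1977Simplicial, p. 118] -/
theorem cutLocus_subset_firstConjugateLocus_union [ConnectedSpace M] (hn : (∞ : ℕ∞ω) ≤ n)
    (hg : g.IsRiemannian) (hc : IsGeodesicallyComplete g.leviCivita) (p : M) :
    cutLocus g hg p ⊆ firstConjugateLocus g p ∪
      {q | ∃ v w : TangentSpace I p, v ≠ w ∧ IsMinimizingUpTo g hg p v 1 ∧
        IsMinimizingUpTo g hg p w 1 ∧ riemannianExpMap g p v = q ∧ riemannianExpMap g p w = q} := by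
  intro q hq
  obtain ⟨v, -, hmin, hvq, hconj | ⟨w, hwv, hw, hwq⟩⟩ :=
    (mem_cutLocus_iff_exists_minimizer hn hg hc).1 hq
  · left
    rw [← hvq]
    exact expMap_mem_firstConjugateLocus hn hg hc hmin hconj
  · right
    exact ⟨v, w, hwv.symm, hmin, hw, hvq, hwq⟩

/-- **Buchner's characterisation as an equality of sets**: the metric cut locus of `p` is the union
of the first conjugate points along MINIMIZING segments from `p` and of the points reached by two
distinct minimizing segments (Buchner 1977, p. 118). [cite: Buchner1977Simplicial, p. 118] -/
theorem cutLocus_eq_setOf_conjugate_union [ConnectedSpace M] (hn : (∞ : ℕ∞ω) ≤ n)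
    (hg : g.IsRiemannian) (hc : IsGeodesicallyComplete g.leviCivita) (p : M) :
    cutLocus g hg p =
      {q | ∃ v : TangentSpace I p, v ≠ 0 ∧ IsMinimizingUpTo g hg p v 1 ∧ IsConjugateVector g p v ∧
          riemannianExpMap g p v = q} ∪
      {q | ∃ v w : TangentSpace I p, v ≠ w ∧ IsMinimizingUpTo g hg p v 1 ∧
          IsMinimizingUpTo g hg p w 1 ∧ riemannianExpMap g p v = q ∧ riemannianExpMap g p w = q} := by
  ext q
  rw [mem_cutLocus_iff_exists_minimizer hn hg hc]
  constructor
  · rintro ⟨v, hv0, hmin, hvq, hconj | ⟨w, hwv, hw, hwq⟩⟩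
    · exact Or.inl ⟨v, hv0, hmin, hconj, hvq⟩
    · exact Or.inr ⟨v, w, hwv.symm, hmin, hw, hvq, hwq⟩
  · rintro (⟨v, hv0, hmin, hconj, hvq⟩ | ⟨v, w, hvw, hv, hw, hvq, hwq⟩)
    · exact ⟨v, hv0, hmin, hvq, Or.inl hconj⟩
    · -- one of `v, w` is non-zero; use it as the minimizer
      by_cases hv0 : v = 0
      · subst hv0
        have hw0 : w ≠ 0 := fun h => hvw h.symm
        exact ⟨w, hw0, hw, hwq, Or.inr ⟨0, hvw, hv, hvq⟩⟩
      · exact ⟨v, hv0, hv, hvq, Or.inr ⟨w, Ne.symm hvw, hw, hwq⟩⟩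

/-! ### Compact manifolds -/

/-- Buchner's characterisation on a **compact** connected manifold (smooth Riemannian metric;
`hopfRinow_compact_geodesicallyComplete`) — the setting of
`buchner1977_cutLocus_triangulable`. [cite: Buchner1977Simplicial, p. 118] -/
theorem mem_cutLocus_iff_exists_minimizer_of_compactSpace [CompactSpace M] [ConnectedSpace M]
    (hn : (∞ : ℕ∞ω) ≤ n) (hg : g.IsRiemannian) {p q : M} :
    q ∈ cutLocus g hg p ↔ ∃ v : TangentSpace I p, v ≠ 0 ∧ IsMinimizingUpTo g hg p v 1 ∧
      riemannianExpMap g p v = q ∧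
      (IsConjugateVector g p v ∨ ∃ w : TangentSpace I p, w ≠ v ∧ IsMinimizingUpTo g hg p w 1 ∧
        riemannianExpMap g p w = q) :=
  mem_cutLocus_iff_exists_minimizer hn hg (hopfRinow_compact_geodesicallyComplete hn hg)

/-- Buchner's characterisation as an equality of sets on a **compact** connected manifold.
[cite: Buchner1977Simplicial, p. 118] -/
theorem cutLocus_eq_setOf_conjugate_union_of_compactSpace [CompactSpace M] [ConnectedSpace M]
    (hn : (∞ : ℕ∞ω) ≤ n) (hg : g.IsRiemannian) (p : M) :
    cutLocus g hg p =
      {q | ∃ v : TangentSpace I p, v ≠ 0 ∧ IsMinimizingUpTo g hg p v 1 ∧ IsConjugateVector g p v ∧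
          riemannianExpMap g p v = q} ∪
      {q | ∃ v w : TangentSpace I p, v ≠ w ∧ IsMinimizingUpTo g hg p v 1 ∧
          IsMinimizingUpTo g hg p w 1 ∧ riemannianExpMap g p v = q ∧ riemannianExpMap g p w = q} :=
  cutLocus_eq_setOf_conjugate_union hn hg (hopfRinow_compact_geodesicallyComplete hn hg) p

end Literature.Geometry.Riemannian

end
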